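import Mathlib
import HarnessLib
import Literature.MathematicalPhysics.QuantumLattice.HubbardUVSymbolResummedLipschitz
import Summits.HubbardSuperconductivity.HubbardSuperconductivity.Theorems.KLProgrammeKLRegimeEngineFrameShiftResponseFourLegAmplitude

/-!
# Route `KLProgramme` — ENGINE item stmt-HubbardSuperconductivity-20437 `KLRegimeEngineV17F2`, stub (c) `hshift` producer: the DRESSING DEFECT PRICED
# (`δ ≤ 600·frameDist K₂ K₁/Λ_n`) and the four-leg frame-shift response of the pair amplitude LINEAR in `frameDist` (cell gate-hubbard-kl, seat p2 g24;
# located risk #6 «(c)-HSHIFT-4LEG», pricing half, p2 side)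

p2 g23's `norm_klPairAmplitude_frame_sub_le` (…FrameShiftResponseFourLegAmplitude, p670471) bounds the frame response of the scale-`n` pair amplitude
`‖𝒞_n[K₂](Q;k,k′) − 𝒞_n[K₁](Q;k,k′)‖ ≤ 24(|β|L²)³·(δ·N₄′ + (30·#shell·N₆ + 8·S·N₄)·βL²(200+200B₁)/Λ_n²·fd)` modulo the DRESSING DEFECT
`‖Π_{i<4} m(X_i) − 1‖ ≤ δ`, `m(X) = (1 + Ψ_{K₂}(X)·κ_D(X))⁻¹`, `κ_D(X) = D(p_X)/(βL²)`, `D = K₂ ⊖ K₁`.  This file prices `δ`: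

* §1 `norm_mul_four_sub_one_le` (`‖abcd − 1‖ ≤ (1+ε)⁴ − 1` from `‖· − 1‖ ≤ ε`), `one_add_pow_four_sub_one_le` (`(1+ε)⁴ − 1 ≤ 60ε`, `ε ≤ 5/2`);
* §2 **`norm_dressing_sub_one_le`**: `‖m(X) − 1‖ ≤ 10·|D(p_X)|/Λ` for `|D(p_X)| ≤ Λ/4` — because `m − 1 = −κ_D·Ψ̃` with `Ψ̃ = Ψ_{K₂}/(1 + Ψ_{K₂}κ_D)` the
  mismatch-resummed symbol (k3c4-p2's `mismatchResummed_eq_uvResummedFn`) and `‖Ψ̃‖ ≤ 10·βL²/Λ` (Literature `norm_uvResummedFn_le`: zero below the shell,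
  denominator `≥ Λ/10` on and above it); FIRST order in the frame value, uniform in the frequency; **`norm_prod_dressing_sub_one_le`**:
  `‖Π_{i<4} m(X_i) − 1‖ ≤ 600·frameDist K₂ K₁/Λ` (`fd ≤ Λ/4` ⇒ `ε = 10fd/Λ ≤ 5/2`);
* §3 **`norm_klPairAmplitude_frame_sub_le_linear`**: p670471 with `hm` DISCHARGED — `‖𝒞_n[K₂] − 𝒞_n[K₁]‖ ≤ ℓ·frameDist K₂ K₁` with the EXPLICIT
  `ℓ = 24(|β|L²)³·(600·N₄′/Λ_n + (30·#{|ω|<Λ_n}·N₆ + 8·S·N₄)·βL²(200+200B₁)/Λ_n²)` — the `hresp` shape of k3c2-p2's `hshift_of_frameResponse(_hist)` modulo the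
  four kernel sizes `N₄′, N₆, S, N₄` only.

ORDER COUNT (located «(c)-HSHIFT-ORDER1», bus 2026-08-28): `N₄′` (the four-leg kernel of `𝒲′[Ψ̃]` at the pair string) is of FIRST order in `U`, so the dressing
share `600·N₄′/Λ_n` of `ℓ` is `∝ Klam·U/Λ_n`, not `∝ (Klam·U)²/Λ_n`: it is hosted by the first-order door of `…EnginePairTransferOutClassFrameShiftOrders`
(`hshift_of_frameResponse_orders`, U-free CR-row), the other two shares by the second-order door (`klHshiftC`).  Proofs only; no definitions; the sizes
`N₄′, N₆, S, N₄` stay hypotheses; nothing here asserts (c), any stub of 20437, K3, the margin or superconductivity.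
References: BGM 2006 §2.2–2.3 (2.21)–(2.28) [cite: BenfattoGiulianiMastropietro2006]; FST 1996 §1 [cite: FeldmanSalmhoferTrubowitz1996].
-/

noncomputable section

namespace Summit.HubbardSuperconductivity.HubbardSuperconductivity.Theorems.EngineV8

set_option linter.dupNamespace false -- summit = problem name (single-conjunct summit), D-0017

open Finset Literature.MathematicalPhysics.QuantumLattice Literature.Probability.LatticeModels GrassmannAlgebra
open Summit.HubbardSuperconductivity.HubbardSuperconductivity.Theorems.TwoPointAssembly
open Summit.HubbardSuperconductivity.HubbardSuperconductivity.Theorems.TwoVolumeDefect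
open Summit.HubbardSuperconductivity.HubbardSuperconductivity.Theorems.KLRegimeSplit
open Summit.HubbardSuperconductivity.HubbardSuperconductivity.Theorems.KLProgrammeLegKernels

/-! ## §1 Four dressed legs: `‖abcd − 1‖ ≤ (1 + ε)⁴ − 1 ≤ 60·ε` -/

/-- **Four dressed legs**: in a normed ring, if `‖a − 1‖, ‖b − 1‖, ‖c − 1‖, ‖d − 1‖ ≤ ε` then `‖a·b·c·d − 1‖ ≤ (1 + ε)⁴ − 1`
(telescoping `abcd − 1 = (a−1)bcd + (b−1)cd + (c−1)d + (d−1)`). -/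
theorem norm_mul_four_sub_one_le {A : Type*} [NormedRing A] [NormOneClass A] {a b c d : A} {ε : ℝ}
    (ha : ‖a - 1‖ ≤ ε) (hb : ‖b - 1‖ ≤ ε) (hc : ‖c - 1‖ ≤ ε) (hd : ‖d - 1‖ ≤ ε) :
    ‖a * b * c * d - 1‖ ≤ (1 + ε) ^ 4 - 1 := by
  have hε : 0 ≤ ε := (norm_nonneg _).trans ha
  have hn : ∀ {y : A}, ‖y - 1‖ ≤ ε → ‖y‖ ≤ 1 + ε := fun {y} hy => by
    calc ‖y‖ = ‖(y - 1) + 1‖ := by rw [sub_add_cancel]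
      _ ≤ ‖y - 1‖ + ‖(1 : A)‖ := norm_add_le _ _
      _ ≤ ε + 1 := by rw [norm_one]; exact add_le_add hy le_rfl
      _ = 1 + ε := add_comm _ _
  have hid : a * b * c * d - 1 = (a - 1) * b * c * d + (b - 1) * c * d + (c - 1) * d + (d - 1) := by noncomm_ring
  rw [hid]
  calc ‖(a - 1) * b * c * d + (b - 1) * c * d + (c - 1) * d + (d - 1)‖
      ≤ ‖a - 1‖ * ‖b‖ * ‖c‖ * ‖d‖ + ‖b - 1‖ * ‖c‖ * ‖d‖ + ‖c - 1‖ * ‖d‖ + ‖d - 1‖ := by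
        refine (norm_add_le _ _).trans (add_le_add ((norm_add_le _ _).trans (add_le_add ((norm_add_le _ _).trans (add_le_add ?_ ?_)) ?_)) le_rfl)
        · exact (norm_mul_le _ _).trans (mul_le_mul_of_nonneg_right ((norm_mul_le _ _).trans
            (mul_le_mul_of_nonneg_right (norm_mul_le _ _) (norm_nonneg _))) (norm_nonneg _))
        · exact (norm_mul_le _ _).trans (mul_le_mul_of_nonneg_right (norm_mul_le _ _) (norm_nonneg _))
        · exact norm_mul_le _ _
    _ ≤ ε * (1 + ε) * (1 + ε) * (1 + ε) + ε * (1 + ε) * (1 + ε) + ε * (1 + ε) + ε := by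
        gcongr <;> exact hn ‹_›
    _ = (1 + ε) ^ 4 - 1 := by ring

/-- `(1 + ε)⁴ − 1 ≤ 60·ε` for `0 ≤ ε ≤ 5/2` (`= ε(4 + 6ε + 4ε² + ε³) ≤ 59.625·ε`). -/
theorem one_add_pow_four_sub_one_le {ε : ℝ} (h0 : 0 ≤ ε) (h : ε ≤ 5 / 2) : (1 + ε) ^ 4 - 1 ≤ 60 * ε := by
  nlinarith [mul_nonneg h0 h0, mul_nonneg (mul_nonneg h0 h0) h0, mul_nonneg (mul_nonneg h0 h0) (sub_nonneg.2 h),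
    mul_nonneg h0 (sub_nonneg.2 h), mul_nonneg (mul_nonneg (mul_nonneg h0 h0) h0) (sub_nonneg.2 h)]

/-! ## §2 The dressing factor `m(X) = (1 + Ψ_{K₂}(X)·κ_D(X))⁻¹` is within `10·|D(p_X)|/Λ` of `1` -/

section Dressing

variable {L M : ℕ} [NeZero L] {β : ℝ} (hβ : 0 < β) (μ : ℝ) (K₁ K₂ : TrigPolyC4v) {Λ : ℝ} (hΛ : 0 < Λ)
include hβ hΛ

/-- **The dressing factor's defect, one leg**: for `|D(p_X)| ≤ Λ/4` (`D = K₂ ⊖ K₁`),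
`‖(1 + Ψ_{K₂}(X)·D(p_X)/(βL²))⁻¹ − 1‖ ≤ 10·|D(p_X)|/Λ` — `m − 1 = −κ_D·Ψ̃` and `‖Ψ̃‖ ≤ 10βL²/Λ` (FIRST order in the frame value, uniform in `ω`).
[cite: BenfattoGiulianiMastropietro2006, §2.2 (2.21)–(2.24), (2.27)–(2.28)] -/
theorem norm_dressing_sub_one_le (ks : FreqMomentum L M × Fin 2) (hD : |(fsub K₂ K₁).eval (latticeMomentum L ks.1.2)| ≤ Λ / 4) :
    ‖(1 + uvSymbolCT L M β μ K₂ Λ ks * (((fsub K₂ K₁).eval (latticeMomentum L ks.1.2) / (β * (L : ℝ) ^ 2) : ℝ) : ℂ))⁻¹ - 1‖ ≤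
      10 * |(fsub K₂ K₁).eval (latticeMomentum L ks.1.2)| / Λ := by
  obtain ⟨⟨i, kv⟩, σ⟩ := ks
  have hL : (0 : ℝ) < L := by exact_mod_cast NeZero.pos L
  have hc : 0 < β * (L : ℝ) ^ 2 := by positivity
  dsimp only
  rw [uvSymbolCT_eq_uvSymbolFn hβ, nambuXiCT_eq_sub_eval_fsub (L := L) μ K₁ K₂ kv]
  exact norm_inv_one_add_uvSymbolFn_mul_sub_one_le hc hΛ (matsubaraFreq_ne_zero hβ.ne' i) _ hD

/-- **The dressing defect of a four-leg string, priced**: for `frameDist K₂ K₁ ≤ Λ/4`,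
`‖Π_{i<4} (1 + Ψ_{K₂}(X_i)·D(p_{X_i})/(βL²))⁻¹ − 1‖ ≤ 600·frameDist K₂ K₁/Λ` (`ε = 10·fd/Λ ≤ 5/2`, `(1+ε)⁴ − 1 ≤ 60ε`).
[cite: BenfattoGiulianiMastropietro2006, §2.2 (2.21)–(2.24), (2.27)–(2.28)] -/
theorem norm_prod_dressing_sub_one_le (hfd : frameDist K₂ K₁ ≤ Λ / 4) (X : Fin 4 → HubbardFieldIdx L M) :
    ‖(∏ i : Fin 4, (1 + uvSymbolCT L M β μ K₂ Λ (X i).1 *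
          (((fsub K₂ K₁).eval (latticeMomentum L (X i).1.1.2) / (β * (L : ℝ) ^ 2) : ℝ) : ℂ))⁻¹) - 1‖ ≤
      600 * frameDist K₂ K₁ / Λ := by
  have hfd0 : 0 ≤ frameDist K₂ K₁ := frameDist_nonneg K₂ K₁
  have hDle : ∀ kv : TorusSite 2 L, |(fsub K₂ K₁).eval (latticeMomentum L kv)| ≤ frameDist K₂ K₁ := fun kv => by
    rw [eval_fsub]; exact abs_eval_sub_le_frameDist K₂ K₁ _
  have hleg : ∀ i : Fin 4, ‖(1 + uvSymbolCT L M β μ K₂ Λ (X i).1 *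
      (((fsub K₂ K₁).eval (latticeMomentum L (X i).1.1.2) / (β * (L : ℝ) ^ 2) : ℝ) : ℂ))⁻¹ - 1‖ ≤ 10 * frameDist K₂ K₁ / Λ := fun i =>
    (norm_dressing_sub_one_le hβ μ K₁ K₂ hΛ (X i).1 ((hDle _).trans hfd)).trans (by gcongr; exact hDle _)
  rw [Fin.prod_univ_four]
  refine (norm_mul_four_sub_one_le (hleg 0) (hleg 1) (hleg 2) (hleg 3)).trans ?_
  have hε0 : 0 ≤ 10 * frameDist K₂ K₁ / Λ := by positivity
  have hε : 10 * frameDist K₂ K₁ / Λ ≤ 5 / 2 := by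
    rw [div_le_iff₀ hΛ]; linarith
  calc (1 + 10 * frameDist K₂ K₁ / Λ) ^ 4 - 1 ≤ 60 * (10 * frameDist K₂ K₁ / Λ) := one_add_pow_four_sub_one_le hε0 hε
    _ = 600 * frameDist K₂ K₁ / Λ := by ring

end Dressing

/-! ## §3 The frame-shift response of the pair amplitude, LINEAR in `frameDist K₂ K₁` (dressing discharged) -/

variable {L M : ℕ} [NeZero L] [NeZero M]

/-- **THE FRAME-SHIFT RESPONSE OF THE PAIR AMPLITUDE, LINEAR FORM** (`hresp` of `hshift_of_frameResponse(_orders)` modulo the four kernel sizes): under the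
hypotheses of `norm_klPairAmplitude_frame_sub_le` WITHOUT the dressing hypothesis `hm` (priced by `norm_prod_dressing_sub_one_le`),
`‖𝒞_n[K₂](Q;k,k′) − 𝒞_n[K₁](Q;k,k′)‖ ≤ ℓ·frameDist K₂ K₁`,
`ℓ = 24(|β|L²)³·(600·N₄′/Λ_n + (30·#{|ω|<Λ_n}·N₆ + 8·S·N₄)·βL²(200+200B₁)/Λ_n²)`.
[cite: BenfattoGiulianiMastropietro2006, §2.3 (2.21)–(2.24)] -/
theorem norm_klPairAmplitude_frame_sub_le_linear {β : ℝ} (hβ : 0 < β) {B₁ : ℝ} (hB0 : 0 ≤ B₁) (hB : ∀ y, |deriv salmhoferCutoff y| ≤ B₁)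
    (U μ : ℝ) (K₁ K₂ : TrigPolyC4v) (n : ℕ) (hfd : frameDist K₂ K₁ ≤ klScale klE0 n / 4)
    (hZ₂ : effPartitionFn ℂ (normalCovariance L M (uvSymbolCT L M β μ K₂ (klScale klE0 n)))
      (hubbardInteraction L M β U + counterQuadratic L M β K₂) ≠ 0)
    {s₀ s₁ : FreqMomentum L M × Fin 2 → ℂ} (hs₀ : s₀ = uvSymbolCT L M β μ K₁ (klScale klE0 n))
    (hs₁ : s₁ = fun ks => uvSymbolCT L M β μ K₂ (klScale klE0 n) ks /
      (1 + uvSymbolCT L M β μ K₂ (klScale klE0 n) ks * (((fsub K₂ K₁).eval (latticeMomentum L ks.1.2) / (β * (L : ℝ) ^ 2) : ℝ) : ℂ)))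
    (Q k k' : TorusSite 2 L) {N₄' N₆ S N₄ : ℝ}
    (hN4' : ‖kernel ℂ (effAction ℂ (normalCovariance L M s₁) (hubbardInteraction L M β U + counterQuadratic L M β K₁)) 4
      ![(((omega0 M, k'), 0), 0), ((((omega0 M).rev, Q - k'), 1), 0), ((((omega0 M).rev, Q - k), 1), 1), (((omega0 M, k), 0), 1)]‖ ≤ N₄')
    (hZ : ∀ t ∈ Set.Icc (0 : ℝ) 1, effPartitionFn ℂ (normalCovariance L M s₀ + ((t : ℂ)) • (normalCovariance L M s₁ - normalCovariance L M s₀))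
      (hubbardInteraction L M β U + counterQuadratic L M β K₁) ≠ 0)
    (hN6 : ∀ t ∈ Set.Icc (0 : ℝ) 1, ∀ A : HubbardFieldIdx L M,
      ‖kernel ℂ (effAction ℂ (normalCovariance L M s₀ + ((t : ℂ)) • (normalCovariance L M s₁ - normalCovariance L M s₀))
        (hubbardInteraction L M β U + counterQuadratic L M β K₁)) 6
        (Fin.snoc (Fin.snoc ![(((omega0 M, k'), 0), 0), ((((omega0 M).rev, Q - k'), 1), 0), ((((omega0 M).rev, Q - k), 1), 1),
          (((omega0 M, k), 0), 1)] (A.1, 1 - A.2) : Fin 5 → HubbardFieldIdx L M) A)‖ ≤ N₆)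
    (hS : ∀ t ∈ Set.Icc (0 : ℝ) 1, ∀ i : Fin 4,
      ‖kernel ℂ (effAction ℂ (normalCovariance L M s₀ + ((t : ℂ)) • (normalCovariance L M s₁ - normalCovariance L M s₀))
        (hubbardInteraction L M β U + counterQuadratic L M β K₁)) 2
        ![((((![(((omega0 M, k'), 0), 0), ((((omega0 M).rev, Q - k'), 1), 0), ((((omega0 M).rev, Q - k), 1), 1), (((omega0 M, k), 0), 1)] :
              Fin 4 → HubbardFieldIdx L M) i).1,
            1 - ((![(((omega0 M, k'), 0), 0), ((((omega0 M).rev, Q - k'), 1), 0), ((((omega0 M).rev, Q - k), 1), 1), (((omega0 M, k), 0), 1)] :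
              Fin 4 → HubbardFieldIdx L M) i).2) : HubbardFieldIdx L M),
          (![(((omega0 M, k'), 0), 0), ((((omega0 M).rev, Q - k'), 1), 0), ((((omega0 M).rev, Q - k), 1), 1), (((omega0 M, k), 0), 1)] :
              Fin 4 → HubbardFieldIdx L M) i]‖ ≤ S)
    (hN4 : ∀ t ∈ Set.Icc (0 : ℝ) 1,
      ‖kernel ℂ (effAction ℂ (normalCovariance L M s₀ + ((t : ℂ)) • (normalCovariance L M s₁ - normalCovariance L M s₀))
        (hubbardInteraction L M β U + counterQuadratic L M β K₁)) 4
        ![(((omega0 M, k'), 0), 0), ((((omega0 M).rev, Q - k'), 1), 0), ((((omega0 M).rev, Q - k), 1), 1), (((omega0 M, k), 0), 1)]‖ ≤ N₄) :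
    ‖klPairAmplitude L M β U μ K₂ n Q k k' - klPairAmplitude L M β U μ K₁ n Q k k'‖ ≤
      (24 * (|β| * (L : ℝ) ^ 2) ^ 3 *
        (600 * N₄' / klScale klE0 n +
          (30 * ((((Finset.univ.filter fun ks : FreqMomentum L M × Fin 2 => |matsubaraFreq β M ks.1.1| < klScale klE0 n).card : ℕ) : ℝ) * N₆) +
              8 * S * N₄) * (β * (L : ℝ) ^ 2 * (200 + 200 * B₁) / klScale klE0 n ^ 2))) * frameDist K₂ K₁ := by
  have hΛ : 0 < klScale klE0 n := klth_klScale_pos n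
  have hδ := norm_prod_dressing_sub_one_le hβ μ K₁ K₂ hΛ hfd
    ![(((omega0 M, k'), 0), 0), ((((omega0 M).rev, Q - k'), 1), 0), ((((omega0 M).rev, Q - k), 1), 1), (((omega0 M, k), 0), 1)]
  have h := norm_klPairAmplitude_frame_sub_le hβ hB0 hB U μ K₁ K₂ n hfd hZ₂ hs₀ hs₁ Q k k' hδ hN4' hZ hN6 hS hN4
  refine h.trans (le_of_eq ?_)
  ring


/-! ## §4 The FIRST-ORDER share priced by the pair amplitude itself: `‖𝒲′[Ψ̃]₄(X)‖ ≤ (1 + 2fd/Λ_n)⁴·‖T_n(K₂)₄(X)‖ ≤ (81/16)·‖T_n(K₂)₄(X)‖`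

`T_n(K₂)₄(X) = (Π_i m(X_i))·𝒲′[Ψ̃]₄(X)` (the chain has no four-leg kernel) and `1/m(X) = 1 + Ψ_{K₂}(X)κ_D(X)` with `‖Ψ_{K₂}‖ ≤ 2βL²/Λ`
(`norm_uvSymbolFn_le`), `|κ_D| ≤ fd/(βL²)`: so the undressed size `N₄′` is read off the DRESSED kernel at the new frame — the pair amplitude
`𝒞_n[K₂](Q;k,k′)` that (E1-v4)/(E2-F2) already size — with the factor `(1 + 2fd/Λ_n)⁴ ≤ (3/2)⁴`. -/

section FirstOrder

omit [NeZero M] in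
/-- `‖1 + Ψ_{K₂}(X)·D(p_X)/(βL²)‖ ≤ 1 + 2·t/Λ` when `|D(p_X)| ≤ t` (`‖Ψ‖ ≤ βL²/max(|ω|, Λ/2) ≤ 2βL²/Λ`).
[cite: BenfattoGiulianiMastropietro2006, §2.2 (2.27)–(2.28)] -/
theorem norm_one_add_uvSymbolCT_mul_le {β : ℝ} (hβ : 0 < β) (μ : ℝ) (K₁ K₂ : TrigPolyC4v) {Λ : ℝ} (hΛ : 0 < Λ)
    (ks : FreqMomentum L M × Fin 2) {t : ℝ} (hD : |(fsub K₂ K₁).eval (latticeMomentum L ks.1.2)| ≤ t) :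
    ‖1 + uvSymbolCT L M β μ K₂ Λ ks * (((fsub K₂ K₁).eval (latticeMomentum L ks.1.2) / (β * (L : ℝ) ^ 2) : ℝ) : ℂ)‖ ≤ 1 + 2 * t / Λ := by
  obtain ⟨⟨i, kv⟩, σ⟩ := ks
  have hL : (0 : ℝ) < L := by exact_mod_cast NeZero.pos L
  have hc : 0 < β * (L : ℝ) ^ 2 := by positivity
  have ht : 0 ≤ t := (abs_nonneg _).trans hD
  dsimp only at hD ⊢
  refine (norm_add_le _ _).trans ?_
  rw [norm_one, norm_mul, Complex.norm_real, Real.norm_eq_abs, abs_div, abs_of_pos hc, uvSymbolCT_eq_uvSymbolFn hβ]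
  have hΨ := norm_uvSymbolFn_le (e := nambuXiCT L μ K₂ kv) hΛ hc.le (matsubaraFreq β M i)
  have hmax : Λ / 2 ≤ max |matsubaraFreq β M i| (Λ / 2) := le_max_right _ _
  have hΨ2 : ‖uvSymbolFn (β * (L : ℝ) ^ 2) Λ (nambuXiCT L μ K₂ kv) (matsubaraFreq β M i)‖ ≤ β * (L : ℝ) ^ 2 / (Λ / 2) :=
    hΨ.trans (div_le_div_of_nonneg_left hc.le (by positivity) hmax)
  have h1 : ‖uvSymbolFn (β * (L : ℝ) ^ 2) Λ (nambuXiCT L μ K₂ kv) (matsubaraFreq β M i)‖ *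
      (|(fsub K₂ K₁).eval (latticeMomentum L kv)| / (β * (L : ℝ) ^ 2)) ≤ β * (L : ℝ) ^ 2 / (Λ / 2) * (t / (β * (L : ℝ) ^ 2)) :=
    mul_le_mul hΨ2 (by gcongr) (by positivity) (by positivity)
  calc 1 + ‖uvSymbolFn (β * (L : ℝ) ^ 2) Λ (nambuXiCT L μ K₂ kv) (matsubaraFreq β M i)‖ *
        (|(fsub K₂ K₁).eval (latticeMomentum L kv)| / (β * (L : ℝ) ^ 2))
      ≤ 1 + β * (L : ℝ) ^ 2 / (Λ / 2) * (t / (β * (L : ℝ) ^ 2)) := by linarith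
    _ = 1 + 2 * t / Λ := by field_simp

/-- **`T_n(K₂)₄(X) = (Π_i m(X_i))·𝒲′[Ψ̃]₄(X)`** — the mismatch resummation at a four-leg string (chain drops, `S_m` multiplies by the dressing product).
[cite: BenfattoGiulianiMastropietro2006, §2.3 (2.21)–(2.24)] -/
theorem kernel_four_klEffectiveAction_eq_prod_mul {β : ℝ} (hβ : 0 < β) (U μ : ℝ) (K₁ K₂ : TrigPolyC4v) (n : ℕ)
    (hZ₂ : effPartitionFn ℂ (normalCovariance L M (uvSymbolCT L M β μ K₂ (klScale klE0 n)))
      (hubbardInteraction L M β U + counterQuadratic L M β K₂) ≠ 0)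
    (X : Fin 4 → HubbardFieldIdx L M) :
    kernel ℂ (klEffectiveAction L M β U μ K₂ klE0 n) 4 X =
      (∏ i : Fin 4, (1 + uvSymbolCT L M β μ K₂ (klScale klE0 n) (X i).1 *
            (((fsub K₂ K₁).eval (latticeMomentum L (X i).1.1.2) / (β * (L : ℝ) ^ 2) : ℝ) : ℂ))⁻¹) *
        kernel ℂ (effAction ℂ (normalCovariance L M fun ks =>
            uvSymbolCT L M β μ K₂ (klScale klE0 n) ks /
              (1 + uvSymbolCT L M β μ K₂ (klScale klE0 n) ks *
                (((fsub K₂ K₁).eval (latticeMomentum L ks.1.2) / (β * (L : ℝ) ^ 2) : ℝ) : ℂ)))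
          (hubbardInteraction L M β U + counterQuadratic L M β K₁)) 4 X := by
  rw [klEffectiveAction_eq_chain_add_map_mismatchResummed hβ U μ K₁ K₂ klE0 n hZ₂, kernel_add,
    kernel_four_effAction_counterQuadratic_eq_zero hβ μ K₂ (fsub K₂ K₁) _ X, zero_add, kernel_map_mulLeft]

/-- **THE UNDRESSED FOUR-LEG SIZE FROM THE DRESSED ONE** (any two frames):
`‖𝒲′[Ψ̃]₄(X)‖ ≤ (1 + 2·frameDist K₂ K₁/Λ_n)⁴ · ‖T_n(K₂)₄(X)‖` (`𝒲′[Ψ̃]₄ = Π_i (1 + Ψ_{K₂}κ_D)(X_i) · T_n(K₂)₄`).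
[cite: BenfattoGiulianiMastropietro2006, §2.3 (2.21)–(2.24)] -/
theorem norm_kernel_four_mismatchResummed_le {β : ℝ} (hβ : 0 < β) (U μ : ℝ) (K₁ K₂ : TrigPolyC4v) (n : ℕ)
    (hZ₂ : effPartitionFn ℂ (normalCovariance L M (uvSymbolCT L M β μ K₂ (klScale klE0 n)))
      (hubbardInteraction L M β U + counterQuadratic L M β K₂) ≠ 0)
    (X : Fin 4 → HubbardFieldIdx L M) :
    ‖kernel ℂ (effAction ℂ (normalCovariance L M fun ks =>
            uvSymbolCT L M β μ K₂ (klScale klE0 n) ks /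
              (1 + uvSymbolCT L M β μ K₂ (klScale klE0 n) ks *
                (((fsub K₂ K₁).eval (latticeMomentum L ks.1.2) / (β * (L : ℝ) ^ 2) : ℝ) : ℂ)))
          (hubbardInteraction L M β U + counterQuadratic L M β K₁)) 4 X‖ ≤
      (1 + 2 * frameDist K₂ K₁ / klScale klE0 n) ^ 4 * ‖kernel ℂ (klEffectiveAction L M β U μ K₂ klE0 n) 4 X‖ := by
  have hΛ : 0 < klScale klE0 n := klth_klScale_pos n
  set z : Fin 4 → ℂ := fun i => 1 + uvSymbolCT L M β μ K₂ (klScale klE0 n) (X i).1 *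
      (((fsub K₂ K₁).eval (latticeMomentum L (X i).1.1.2) / (β * (L : ℝ) ^ 2) : ℝ) : ℂ) with hz
  have hz0 : ∀ i, z i ≠ 0 := fun i => one_add_uvSymbolCT_mul_ofReal_ne_zero hβ μ K₂ (klScale klE0 n) _ (X i).1
  have hid := kernel_four_klEffectiveAction_eq_prod_mul (L := L) (M := M) hβ U μ K₁ K₂ n hZ₂ X
  have hprod : (∏ i : Fin 4, (z i)⁻¹) ≠ 0 := Finset.prod_ne_zero_iff.2 fun i _ => inv_ne_zero (hz0 i)
  -- `𝒲′₄ = (Π m)⁻¹ · T₄`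
  have hW : kernel ℂ (effAction ℂ (normalCovariance L M fun ks =>
            uvSymbolCT L M β μ K₂ (klScale klE0 n) ks /
              (1 + uvSymbolCT L M β μ K₂ (klScale klE0 n) ks *
                (((fsub K₂ K₁).eval (latticeMomentum L ks.1.2) / (β * (L : ℝ) ^ 2) : ℝ) : ℂ)))
          (hubbardInteraction L M β U + counterQuadratic L M β K₁)) 4 X =
      (∏ i : Fin 4, z i) * kernel ℂ (klEffectiveAction L M β U μ K₂ klE0 n) 4 X := by
    rw [hid, ← mul_assoc, ← Finset.prod_mul_distrib, Finset.prod_congr rfl fun i _ => mul_inv_cancel₀ (hz0 i),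
      Finset.prod_const_one, one_mul]
  rw [hW, norm_mul]
  refine mul_le_mul_of_nonneg_right ?_ (norm_nonneg _)
  have hDle : ∀ kv : TorusSite 2 L, |(fsub K₂ K₁).eval (latticeMomentum L kv)| ≤ frameDist K₂ K₁ := fun kv => by
    rw [eval_fsub]; exact abs_eval_sub_le_frameDist K₂ K₁ _
  have hzi : ∀ i, ‖z i‖ ≤ 1 + 2 * frameDist K₂ K₁ / klScale klE0 n := fun i =>
    norm_one_add_uvSymbolCT_mul_le hβ μ K₁ K₂ hΛ (X i).1 (hDle _)
  calc ‖∏ i : Fin 4, z i‖ ≤ ∏ i : Fin 4, ‖z i‖ := Finset.norm_prod_le _ _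
    _ ≤ ∏ _i : Fin 4, (1 + 2 * frameDist K₂ K₁ / klScale klE0 n) := Finset.prod_le_prod (fun i _ => norm_nonneg _) fun i _ => hzi i
    _ = (1 + 2 * frameDist K₂ K₁ / klScale klE0 n) ^ 4 := by rw [Finset.prod_const, Finset.card_univ, Fintype.card_fin]

/-- `(1 + 2fd/Λ)⁴ ≤ 81/16` for `fd ≤ Λ/4`. -/
theorem one_add_two_mul_div_pow_four_le {fd Λ : ℝ} (hΛ : 0 < Λ) (h0 : 0 ≤ fd) (hfd : fd ≤ Λ / 4) :
    (1 + 2 * fd / Λ) ^ 4 ≤ 81 / 16 := by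
  have h1 : 2 * fd / Λ ≤ 1 / 2 := by rw [div_le_iff₀ hΛ]; linarith
  have h2 : 0 ≤ 2 * fd / Λ := by positivity
  nlinarith [mul_nonneg h2 h2, mul_nonneg (mul_nonneg h2 h2) h2, mul_nonneg (mul_nonneg h2 h2) (mul_nonneg h2 h2)]

/-- **THE FRAME-SHIFT RESPONSE OF THE PAIR AMPLITUDE WITH THE FIRST-ORDER SHARE PRICED BY THE PAIR AMPLITUDE ITSELF**: as
`norm_klPairAmplitude_frame_sub_le_linear`, with the undressed size `N₄′` replaced by a bound `A₄` on the DRESSED amplitude `‖𝒞_n[K₂](Q;k,k′)‖ ≤ A₄`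
(`24(|β|L²)³·N₄′ ≤ (81/16)·A₄`):
`‖𝒞_n[K₂] − 𝒞_n[K₁]‖ ≤ ((6075/2)·A₄/Λ_n + 24(|β|L²)³·(30·#{|ω|<Λ_n}·N₆ + 8·S·N₄)·βL²(200+200B₁)/Λ_n²)·frameDist K₂ K₁`
(`600·81/16 = 6075/2`).  The first summand is the FIRST-ORDER share `ℓ₁` of `hshift_of_frameResponse_orders` (`A₄ ≲ Klam·|U|`), the second the
second-order share `ℓ₂`. [cite: BenfattoGiulianiMastropietro2006, §2.3 (2.21)–(2.24)] -/
theorem norm_klPairAmplitude_frame_sub_le_priced₁ {β : ℝ} (hβ : 0 < β) {B₁ : ℝ} (hB0 : 0 ≤ B₁) (hB : ∀ y, |deriv salmhoferCutoff y| ≤ B₁)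
    (U μ : ℝ) (K₁ K₂ : TrigPolyC4v) (n : ℕ) (hfd : frameDist K₂ K₁ ≤ klScale klE0 n / 4)
    (hZ₂ : effPartitionFn ℂ (normalCovariance L M (uvSymbolCT L M β μ K₂ (klScale klE0 n)))
      (hubbardInteraction L M β U + counterQuadratic L M β K₂) ≠ 0)
    {s₀ s₁ : FreqMomentum L M × Fin 2 → ℂ} (hs₀ : s₀ = uvSymbolCT L M β μ K₁ (klScale klE0 n))
    (hs₁ : s₁ = fun ks => uvSymbolCT L M β μ K₂ (klScale klE0 n) ks /
      (1 + uvSymbolCT L M β μ K₂ (klScale klE0 n) ks * (((fsub K₂ K₁).eval (latticeMomentum L ks.1.2) / (β * (L : ℝ) ^ 2) : ℝ) : ℂ)))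
    (Q k k' : TorusSite 2 L) {A₄ N₆ S N₄ : ℝ}
    (hC4 : ‖klPairAmplitude L M β U μ K₂ n Q k k'‖ ≤ A₄)
    (hZ : ∀ t ∈ Set.Icc (0 : ℝ) 1, effPartitionFn ℂ (normalCovariance L M s₀ + ((t : ℂ)) • (normalCovariance L M s₁ - normalCovariance L M s₀))
      (hubbardInteraction L M β U + counterQuadratic L M β K₁) ≠ 0)
    (hN6 : ∀ t ∈ Set.Icc (0 : ℝ) 1, ∀ A : HubbardFieldIdx L M,
      ‖kernel ℂ (effAction ℂ (normalCovariance L M s₀ + ((t : ℂ)) • (normalCovariance L M s₁ - normalCovariance L M s₀))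
        (hubbardInteraction L M β U + counterQuadratic L M β K₁)) 6
        (Fin.snoc (Fin.snoc ![(((omega0 M, k'), 0), 0), ((((omega0 M).rev, Q - k'), 1), 0), ((((omega0 M).rev, Q - k), 1), 1),
          (((omega0 M, k), 0), 1)] (A.1, 1 - A.2) : Fin 5 → HubbardFieldIdx L M) A)‖ ≤ N₆)
    (hS : ∀ t ∈ Set.Icc (0 : ℝ) 1, ∀ i : Fin 4,
      ‖kernel ℂ (effAction ℂ (normalCovariance L M s₀ + ((t : ℂ)) • (normalCovariance L M s₁ - normalCovariance L M s₀))
        (hubbardInteraction L M β U + counterQuadratic L M β K₁)) 2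
        ![((((![(((omega0 M, k'), 0), 0), ((((omega0 M).rev, Q - k'), 1), 0), ((((omega0 M).rev, Q - k), 1), 1), (((omega0 M, k), 0), 1)] :
              Fin 4 → HubbardFieldIdx L M) i).1,
            1 - ((![(((omega0 M, k'), 0), 0), ((((omega0 M).rev, Q - k'), 1), 0), ((((omega0 M).rev, Q - k), 1), 1), (((omega0 M, k), 0), 1)] :
              Fin 4 → HubbardFieldIdx L M) i).2) : HubbardFieldIdx L M),
          (![(((omega0 M, k'), 0), 0), ((((omega0 M).rev, Q - k'), 1), 0), ((((omega0 M).rev, Q - k), 1), 1), (((omega0 M, k), 0), 1)] :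
              Fin 4 → HubbardFieldIdx L M) i]‖ ≤ S)
    (hN4 : ∀ t ∈ Set.Icc (0 : ℝ) 1,
      ‖kernel ℂ (effAction ℂ (normalCovariance L M s₀ + ((t : ℂ)) • (normalCovariance L M s₁ - normalCovariance L M s₀))
        (hubbardInteraction L M β U + counterQuadratic L M β K₁)) 4
        ![(((omega0 M, k'), 0), 0), ((((omega0 M).rev, Q - k'), 1), 0), ((((omega0 M).rev, Q - k), 1), 1), (((omega0 M, k), 0), 1)]‖ ≤ N₄) :
    ‖klPairAmplitude L M β U μ K₂ n Q k k' - klPairAmplitude L M β U μ K₁ n Q k k'‖ ≤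
      (6075 / 2 * A₄ / klScale klE0 n +
        24 * (|β| * (L : ℝ) ^ 2) ^ 3 *
          ((30 * ((((Finset.univ.filter fun ks : FreqMomentum L M × Fin 2 => |matsubaraFreq β M ks.1.1| < klScale klE0 n).card : ℕ) : ℝ) * N₆) +
              8 * S * N₄) * (β * (L : ℝ) ^ 2 * (200 + 200 * B₁) / klScale klE0 n ^ 2))) * frameDist K₂ K₁ := by
  have hΛ : 0 < klScale klE0 n := klth_klScale_pos n
  have hL : (0 : ℝ) < L := by exact_mod_cast NeZero.pos L
  have hfd0 : 0 ≤ frameDist K₂ K₁ := frameDist_nonneg K₂ K₁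
  set X : Fin 4 → HubbardFieldIdx L M :=
    ![(((omega0 M, k'), 0), 0), ((((omega0 M).rev, Q - k'), 1), 0), ((((omega0 M).rev, Q - k), 1), 1), (((omega0 M, k), 0), 1)] with hX
  -- the undressed four-leg size from the dressed amplitude
  have hund := norm_kernel_four_mismatchResummed_le (L := L) (M := M) hβ U μ K₁ K₂ n hZ₂ X
  have hA4 : 0 ≤ A₄ := (norm_nonneg _).trans hC4
  have h81 := one_add_two_mul_div_pow_four_le hΛ hfd0 hfd
  have hT : 24 * (|β| * (L : ℝ) ^ 2) ^ 3 * ‖kernel ℂ (klEffectiveAction L M β U μ K₂ klE0 n) 4 X‖ = ‖klPairAmplitude L M β U μ K₂ n Q k k'‖ := by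
    rw [klPairAmplitude_eq_const_mul_kernel, norm_mul, norm_pairAmplitude_const]
  set N₄' : ℝ := ‖kernel ℂ (effAction ℂ (normalCovariance L M s₁) (hubbardInteraction L M β U + counterQuadratic L M β K₁)) 4 X‖ with hN4'def
  have hN4'le : 24 * (|β| * (L : ℝ) ^ 2) ^ 3 * N₄' ≤ 81 / 16 * A₄ := by
    have h1 : N₄' ≤ (1 + 2 * frameDist K₂ K₁ / klScale klE0 n) ^ 4 * ‖kernel ℂ (klEffectiveAction L M β U μ K₂ klE0 n) 4 X‖ := by
      rw [hN4'def, hs₁]; exact hund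
    calc 24 * (|β| * (L : ℝ) ^ 2) ^ 3 * N₄'
        ≤ 24 * (|β| * (L : ℝ) ^ 2) ^ 3 * ((1 + 2 * frameDist K₂ K₁ / klScale klE0 n) ^ 4 * ‖kernel ℂ (klEffectiveAction L M β U μ K₂ klE0 n) 4 X‖) := by
          gcongr
      _ = (1 + 2 * frameDist K₂ K₁ / klScale klE0 n) ^ 4 * ‖klPairAmplitude L M β U μ K₂ n Q k k'‖ := by rw [← hT]; ring
      _ ≤ 81 / 16 * A₄ := mul_le_mul h81 hC4 (norm_nonneg _) (by norm_num)
  have hlin := norm_klPairAmplitude_frame_sub_le_linear hβ hB0 hB U μ K₁ K₂ n hfd hZ₂ hs₀ hs₁ Q k k' (N₄' := N₄') le_rfl hZ hN6 hS hN4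
  refine hlin.trans (mul_le_mul_of_nonneg_right ?_ hfd0)
  -- compare the two coefficients: only the first summand changes
  have hrest : 0 ≤ 24 * (|β| * (L : ℝ) ^ 2) ^ 3 := by positivity
  have e1 : 24 * (|β| * (L : ℝ) ^ 2) ^ 3 * (600 * N₄' / klScale klE0 n) = 600 * (24 * (|β| * (L : ℝ) ^ 2) ^ 3 * N₄') / klScale klE0 n := by ring
  have hfirst : 24 * (|β| * (L : ℝ) ^ 2) ^ 3 * (600 * N₄' / klScale klE0 n) ≤ 6075 / 2 * A₄ / klScale klE0 n := by
    rw [e1, div_le_div_iff_of_pos_right hΛ]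
    linarith
  calc 24 * (|β| * (L : ℝ) ^ 2) ^ 3 * (600 * N₄' / klScale klE0 n +
          (30 * ((((Finset.univ.filter fun ks : FreqMomentum L M × Fin 2 => |matsubaraFreq β M ks.1.1| < klScale klE0 n).card : ℕ) : ℝ) * N₆) +
              8 * S * N₄) * (β * (L : ℝ) ^ 2 * (200 + 200 * B₁) / klScale klE0 n ^ 2))
      = 24 * (|β| * (L : ℝ) ^ 2) ^ 3 * (600 * N₄' / klScale klE0 n) +
          24 * (|β| * (L : ℝ) ^ 2) ^ 3 *
            ((30 * ((((Finset.univ.filter fun ks : FreqMomentum L M × Fin 2 => |matsubaraFreq β M ks.1.1| < klScale klE0 n).card : ℕ) : ℝ) * N₆) +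
                8 * S * N₄) * (β * (L : ℝ) ^ 2 * (200 + 200 * B₁) / klScale klE0 n ^ 2)) := by ring
    _ ≤ _ := by linarith

end FirstOrder

end Summit.HubbardSuperconductivity.HubbardSuperconductivity.Theorems.EngineV8

end
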